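import Summits.BirchSwinnertonDyer.BirchSwinnertonDyer.Theorems.GenusKolyvaginAtTwoGenusPrimitiveSupplyAtTwoArchimedeanSupplyOfParity
import Summits.BirchSwinnertonDyer.BirchSwinnertonDyer.Theorems.GenusKolyvaginAtTwoGenusPrimitiveSupplyAtTwoArchimedeanLevelLaw
import HarnessLib

/-!
# Route `GenusKolyvaginAtTwo`, crux #2 `GenusPrimitiveSupplyAtTwo` (stmt-BirchSwinnertonDyer-22136):
# SUPPLY″ on the WHOLE habitat modulo {PT, Tate χ, Kramer parity} ONLY — T-A AND T-V discharged

Width seat `bsd-line-gk2-p5` g9 (cell `bsd-f1-sign2`, SUPPLY lineage, «UP general-K lane»), file 28 of the series (sequel of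
`…ArchimedeanSupplyOfParity.lean` p639314 and `…ArchimedeanLevelLaw.lean`). THEOREMS ONLY (no definition, no named fact, no `sorry`, no
local instance); helper `--supports stmt-BirchSwinnertonDyer-22136`; no item is closed; BSD is not proved by any of this.

WHAT. File 26 removed T-A from the supply; the remaining cell statement taken BY NAME was T-V `F1Sign2.StrictShaPropagationAtTwo` on the
single row `{Δ_W > 0, #Sel₂(W) = 4}`. File 27's `GenusKolyArch.strictShaPropagation_habitat_of_parity` proves T-V's conclusion on the habitat
modulo {PT, Tate χ, Kramer parity}; this file re-runs the row-1 supply with it and states SUPPLY″ free of every cell statement: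

* §70 `supply_DEF1_posDisc_rowOne_dichotomyAt`, `supply_DEF1_posDisc_rowOne_of_not_descentSignNegAt`, `no_minimalTwin_of_descentSignNegAt` —
  g7's row-1 theorems with `(hV : StrictShaPropagationAtTwo)` replaced by the PER-CURVE dichotomy
  `hVW : (∀ d adm, #Sel₂(W^{(d)}) = 2) ∨ (∀ d adm, #Sel₂(W^{(d)}) = 8)` (proofs verbatim otherwise);
* §71 **`supply_DEF1_minimalTwin_of_parity''`, `supply_DEF1_minimalTwin_habitat_of_parity''`** — g9's SUPPLY″ statements VERBATIM with BOTH
  `hA` and `hV` REMOVED (and the rank hypothesis, which only fed T-V): for `W/ℚ` globally minimal elliptic with `ρ̄_{W,2}` onto, `#Sel₂(W) ∈ {1,4}`,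
  and `¬ F1Sign2.DescentSignNeg W` when `Δ_W > 0 ∧ #Sel₂(W) = 4`: beyond every bound a prime `ℓ ≡ 7 (8)`, `ℓ ∤ N_W`, with `K = ℚ(√−ℓ)`
  carrying every K-clause of crux 22136, `2` split, DEF(W,K) = 1, and a GLOBALLY MINIMAL twin `Wd ≅ W^{(−ℓ)}` with `#Sel₂(Wd) = 2` —
  CONDITIONAL on `hPT` (Milne I 4.10), `hEP` (Milne I 2.8), `hKP : MazurRubin2010.kramerParity ℚ` (Mazur–Rubin Thm. 2.7) ONLY;
  `descentSignNeg_or_forall_minimalTwin_of_parity` — row 1 on `Δ > 0` is decided by the descent sign (mod the same three facts).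

References: [MazurRubin2010] Thm. 2.7, Lemma 2.9, Prop. 3.3, Cor. 3.4 (i); [Kramer1981] §2 Prop. 6, Thm. 1; [GrossLMS1991] §1 (p. 235);
[CremonaMazur2000] §3; [MilneADT2006] I Thm. 2.8, 2.13, 4.10.
-/

set_option linter.dupNamespace false -- tree convention: `Summit.BirchSwinnertonDyer.BirchSwinnertonDyer.Theorems` (summit = sub-problem)
set_option autoImplicit false

noncomputable section

open scoped Classical

open NumberField WeierstrassCurve
open Literature.NumberTheory.EllipticCurves Literature.NumberTheory.QuadraticFields
open Literature.NumberTheory.GaloisRepresentations Literature.NumberTheory.GaloisCohomology Literature.NumberTheory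
open Summit.BirchSwinnertonDyer.Rank1Residual.F1Sign2

namespace Summit.BirchSwinnertonDyer.BirchSwinnertonDyer.Theorems.GenusKolyTwin

open Summit.BirchSwinnertonDyer.BirchSwinnertonDyer.Theorems.GenusKolyTwistingPrime (supply_DEF1_minimalTwin_rowOne_of_duality)
open Summit.BirchSwinnertonDyer.BirchSwinnertonDyer.Theorems.GenusKolyArch
  (strictShaPropagation_habitat_of_parity admissibleTwistSelmerShift_habitat_of_parity)

variable (W : WeierstrassCurve ℚ) [W.IsElliptic] [W.IsGloballyMinimal]

/-! ## §70 g7's row-1 theorems with the per-curve T-V dichotomy -/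

/-- **The dichotomy on row 1 of `Δ > 0`** from the PER-CURVE T-V dichotomy (g7's `supply_DEF1_posDisc_rowOne_dichotomy`, named fact
replaced): EITHER every silent admissible prime supplies the DEF = 1 field and a Sel₂-minimal twin, OR every model of every admissible twist
has `#Sel₂ = 8`. [cite: Kramer1981, Prop. 6] [cite: CremonaMazur2000, §3] -/
theorem supply_DEF1_posDisc_rowOne_dichotomyAt
    (hVW : (∀ d : ℤ, DescAdmissible W d → twistSelmerTwoCard W d = 2) ∨
      (∀ d : ℤ, DescAdmissible W d → twistSelmerTwoCard W d = 8)) :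
    (∀ ⦃ℓ : ℕ⦄, ℓ.Prime → ℓ % 8 = 7 → (∀ p : ℕ, p.Prime → p ∣ W.conductorNorm ℤ → p ≠ 2 → (ℓ : ZMod p) = -1) →
      (∀ x : ZMod ℓ, 4 * x ^ 3 + ((integralModelInt W).b₂ : ZMod ℓ) * x ^ 2 +
        2 * ((integralModelInt W).b₄ : ZMod ℓ) * x + ((integralModelInt W).b₆ : ZMod ℓ) ≠ 0) →
      ∃ (K : Type) (_ : Field K) (_ : NumberField K), IsImaginaryQuadratic K ∧ discr K = -(ℓ : ℤ) ∧ Odd (discr K) ∧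
        discr K ≠ -3 ∧ SatisfiesHeegnerHypothesis (W.conductorNorm ℤ) K ∧
        ¬ IsSquare ((discr K : ℚ) * -|W.Δ|) ∧ ¬ IsSquare ((discr K : ℚ) * (-(2 * |W.Δ|))) ∧
        ((Ideal.span {(2 : ℤ)}).primesOver (𝓞 K)).ncard = 2 ∧
        (∀ [Fact ℓ.Prime], ∀ Q : (W.baseChange ℚ_[ℓ]).toAffine.Point, 2 • Q = 0 → Q = 0) ∧
        ∃ (Wd : WeierstrassCurve ℚ) (_ : Wd.IsElliptic) (_ : Wd.IsGloballyMinimal),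
          (∃ C : VariableChange ℚ, C • W.quadraticTwist (discr K : ℚ) = Wd) ∧ Nat.card (Wd.selmerGroup 2) = 2) ∨
    (∀ d : ℤ, DescAdmissible W d → ∀ (Wd : WeierstrassCurve ℚ) [Wd.IsElliptic],
      (∃ C : VariableChange ℚ, C • W.quadraticTwist (d : ℚ) = Wd) → Nat.card (Wd.selmerGroup 2) = 8) := by
  rcases hVW with hall | hall
  · left
    intro ℓ hℓ hℓ8 hℓN hsilent
    obtain ⟨hDA, hloc, K, _, _, hK, hd, hodd, hd3, hH, h2K, hsq1, hsq2⟩ :=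
      exists_silent_heegnerField_of_prime W hℓ hℓ8 hℓN hsilent
    have htwist : twistSelmerTwoCard W (-(ℓ : ℤ)) = 2 := hall _ hDA
    have hd0 : ((discr K : ℤ) : ℚ) ≠ 0 := by exact_mod_cast NumberField.discr_ne_zero K
    haveI := W.isElliptic_quadraticTwist hd0
    obtain ⟨C, hC⟩ := hasGlobalMinimalModel_rat_holds (W.quadraticTwist ((discr K : ℤ) : ℚ))
    haveI := hC
    refine ⟨K, inferInstance, inferInstance, hK, hd, hodd, hd3, hH, hsq1, hsq2, h2K, hloc,
      C • W.quadraticTwist ((discr K : ℤ) : ℚ), inferInstance, hC, ⟨C, rfl⟩, ?_⟩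
    rw [natCard_selmerGroup_model_eq_twistSelmerTwoCard W (NumberField.discr_ne_zero K) _ ⟨C, rfl⟩, hd, htwist]
  · right
    intro d hd Wd _ hWd
    rw [natCard_selmerGroup_model_eq_twistSelmerTwoCard W hd.1.ne Wd hWd, hall d hd]

/-- **Row 1 on `Δ > 0`, ε = +1, from the per-curve T-V dichotomy** (g7's `supply_DEF1_posDisc_rowOne_of_not_descentSignNeg`, named fact
replaced): `Δ_W > 0`, `ρ̄_{W,2}` onto, `#Sel₂(W) = 4`, NOT `DescentSignNeg W` ⟹ beyond every bound a silent admissible prime with the DEF = 1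
field and a globally minimal twin with `#Sel₂ = 2`. [cite: Kramer1981, Prop. 6] [cite: CremonaMazur2000, §3] -/
theorem supply_DEF1_posDisc_rowOne_of_not_descentSignNegAt
    (hVW : (∀ d : ℤ, DescAdmissible W d → twistSelmerTwoCard W d = 2) ∨
      (∀ d : ℤ, DescAdmissible W d → twistSelmerTwoCard W d = 8))
    (hΔ : 0 < W.Δ) (hsurj : W.HasSurjectiveModNGaloisRep 2) (h4 : Nat.card (W.selmerGroup 2) = 4)
    (hε : ¬ DescentSignNeg W) (b : ℕ) :
    ∃ ℓ : ℕ, b < ℓ ∧ ℓ.Prime ∧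
      (∀ x : ZMod ℓ, 4 * x ^ 3 + ((integralModelInt W).b₂ : ZMod ℓ) * x ^ 2 +
        2 * ((integralModelInt W).b₄ : ZMod ℓ) * x + ((integralModelInt W).b₆ : ZMod ℓ) ≠ 0) ∧
      ∃ (K : Type) (_ : Field K) (_ : NumberField K), IsImaginaryQuadratic K ∧ discr K = -(ℓ : ℤ) ∧ Odd (discr K) ∧
        discr K ≠ -3 ∧ SatisfiesHeegnerHypothesis (W.conductorNorm ℤ) K ∧
        ¬ IsSquare ((discr K : ℚ) * -|W.Δ|) ∧ ¬ IsSquare ((discr K : ℚ) * (-(2 * |W.Δ|))) ∧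
        ((Ideal.span {(2 : ℤ)}).primesOver (𝓞 K)).ncard = 2 ∧
        (∀ [Fact ℓ.Prime], ∀ Q : (W.baseChange ℚ_[ℓ]).toAffine.Point, 2 • Q = 0 → Q = 0) ∧
        ∃ (Wd : WeierstrassCurve ℚ) (_ : Wd.IsElliptic) (_ : Wd.IsGloballyMinimal),
          (∃ C : VariableChange ℚ, C • W.quadraticTwist (discr K : ℚ) = Wd) ∧ Nat.card (Wd.selmerGroup 2) = 2 := by
  obtain ⟨ℓ, hb, hℓ, hℓ8, hℓN, hsil⟩ := exists_silent_prime_gt W hΔ hsurj b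
  rcases supply_DEF1_posDisc_rowOne_dichotomyAt W hVW with hall | hall
  · exact ⟨ℓ, hb, hℓ, hsil, hall hℓ hℓ8 hℓN hsil⟩
  · exfalso
    apply hε
    have hDA := descAdmissible_neg_prime_of_silent W hℓ hℓ8 hℓN hsil
    refine ⟨-(ℓ : ℤ), hDA, ?_⟩
    have hd0 : ((-(ℓ : ℤ) : ℤ) : ℚ) ≠ 0 := by exact_mod_cast neg_ne_zero.mpr (Int.natCast_ne_zero.mpr hℓ.ne_zero)
    haveI := W.isElliptic_quadraticTwist hd0
    have h8 := hall (-(ℓ : ℤ)) hDA (W.quadraticTwist ((-(ℓ : ℤ) : ℤ) : ℚ)) ⟨1, one_smul _ _⟩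
    rw [selmerTwoCard, h4, twistSelmerTwoCard, h8]

/-- **ε = −1 on row 1 of `Δ > 0`: no DEF = 1 Heegner field has a Sel₂-minimal twin**, from the per-curve T-V dichotomy (g7's
`no_minimalTwin_of_descentSignNeg`, named fact replaced). [cite: Kramer1981, Prop. 6] [cite: CremonaMazur2000, §3] -/
theorem no_minimalTwin_of_descentSignNegAt {K : Type} [Field K] [NumberField K]
    (hVW : (∀ d : ℤ, DescAdmissible W d → twistSelmerTwoCard W d = 2) ∨
      (∀ d : ℤ, DescAdmissible W d → twistSelmerTwoCard W d = 8))
    (h4 : Nat.card (W.selmerGroup 2) = 4) (hε : DescentSignNeg W) (hK : IsImaginaryQuadratic K) (hodd : Odd (discr K))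
    (hH : SatisfiesHeegnerHypothesis (W.conductorNorm ℤ) K) (h2K : ((Ideal.span {(2 : ℤ)}).primesOver (𝓞 K)).ncard = 2)
    (hsilent : ∀ (q : ℕ) [Fact q.Prime], (q : ℤ) ∣ discr K → ∀ x : ZMod q,
      4 * x ^ 3 + ((integralModelInt W).b₂ : ZMod q) * x ^ 2 + 2 * ((integralModelInt W).b₄ : ZMod q) * x +
        ((integralModelInt W).b₆ : ZMod q) ≠ 0)
    (Wd : WeierstrassCurve ℚ) [Wd.IsElliptic] (hWd : ∃ C : VariableChange ℚ, C • W.quadraticTwist (discr K : ℚ) = Wd) :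
    Nat.card (Wd.selmerGroup 2) = 8 := by
  have hDA := descAdmissible_discr_of_forall_silent W hK hodd hH h2K hsilent
  obtain ⟨d₀, hd₀, h2x⟩ := hε
  rw [selmerTwoCard, h4] at h2x
  rcases hVW with hall | hall
  · have h2 := hall d₀ hd₀
    omega
  · rw [natCard_selmerGroup_model_eq_twistSelmerTwoCard W (NumberField.discr_ne_zero K) Wd hWd, hall _ hDA]

/-! ## §71 SUPPLY″ on the whole habitat, modulo {PT, Tate χ, Kramer parity} only -/

/-- **Row 1 on `Δ > 0` is decided by the descent sign, modulo {PT, Tate χ, Kramer parity}** (g7's `descentSignNeg_or_forall_minimalTwin`,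
T-V replaced by `strictShaPropagation_habitat_of_parity`). [cite: MazurRubin2010, Thm. 2.7, Cor. 3.4 (i)] [cite: Kramer1981, §2 Prop. 6] -/
theorem descentSignNeg_or_forall_minimalTwin_of_parity (hPT : poitouTate_selmerStructure_duality_real ℚ)
    (hEP : ∀ v : IsDedekindDomain.HeightOneSpectrum (𝓞 ℚ), localEulerPoincareCharacteristic (v.adicCompletion ℚ))
    (hKP : MazurRubin2010.kramerParity ℚ) (hΔ : 0 < W.Δ)
    (hsurj : W.HasSurjectiveModNGaloisRep 2) (h4 : Nat.card (W.selmerGroup 2) = 4) :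
    DescentSignNeg W ∨
      ∀ d : ℤ, DescAdmissible W d → ∀ (Wd : WeierstrassCurve ℚ) [Wd.IsElliptic],
        (∃ C : VariableChange ℚ, C • W.quadraticTwist (d : ℚ) = Wd) → Nat.card (Wd.selmerGroup 2) = 2 := by
  rcases strictShaPropagation_habitat_of_parity W hPT hEP hKP hsurj hΔ (by rw [selmerTwoCard, h4]) with hall | hall
  · right
    intro d hd Wd _ hWd
    rw [natCard_selmerGroup_model_eq_twistSelmerTwoCard W hd.1.ne Wd hWd, hall d hd]
  · left
    obtain ⟨ℓ, -, hℓ, hℓ8, hℓN, hsil⟩ := exists_silent_prime_gt W hΔ hsurj 0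
    refine ⟨-(ℓ : ℤ), descAdmissible_neg_prime_of_silent W hℓ hℓ8 hℓN hsil, ?_⟩
    rw [hall _ (descAdmissible_neg_prime_of_silent W hℓ hℓ8 hℓN hsil), selmerTwoCard, h4]

/-- **SUPPLY″ FOR EVERY HABITAT CURVE, modulo {PT, Tate χ, Kramer parity} ONLY** — g9's `supply_DEF1_minimalTwin_of_parity` VERBATIM with
BOTH cell statements (`hA` T-A, `hV` T-V) REMOVED — and the rank-`0` hypothesis with them (it only fed T-V). For `W/ℚ` globally minimal
elliptic with `ρ̄_{W,2}` onto, `#Sel₂(W) ∈ {1, 4}`,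
and `¬ F1Sign2.DescentSignNeg W` whenever `Δ_W > 0` and `#Sel₂(W) = 4`: beyond every bound `b` a prime `ℓ ≡ 7 (mod 8)`, `ℓ ∤ N_W`, with
`K = ℚ(√−ℓ)` carrying EVERY K-clause of crux 22136, `2` split, DEF(W,K) = 1 (root-count currency), and a GLOBALLY MINIMAL twin
`Wd ≅ W^{(−ℓ)}` with `#Sel₂(Wd) = 2`. CONDITIONAL on `hPT` (Milne I 4.10), `hEP` (Milne I 2.8), `hKP` (Mazur–Rubin Thm. 2.7) only; every
Čebotarev / Dirichlet input PROVED. The twin's analytic rank one is NOT asserted; BSD is not proved by any of this.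
[cite: MazurRubin2010, Thm. 2.7, Prop. 3.3, Cor. 3.4 (i), Prop. 5.3] [cite: Kramer1981, Prop. 6] [cite: GrossLMS1991, §1 (p. 235)] -/
theorem supply_DEF1_minimalTwin_of_parity'' (hKP : MazurRubin2010.kramerParity ℚ)
    (hPT : poitouTate_selmerStructure_duality_real ℚ)
    (hEP : ∀ v : IsDedekindDomain.HeightOneSpectrum (𝓞 ℚ), localEulerPoincareCharacteristic (v.adicCompletion ℚ))
    (hsurj : W.HasSurjectiveModNGaloisRep 2)
    (h14 : Nat.card (W.selmerGroup 2) = 1 ∨ Nat.card (W.selmerGroup 2) = 4)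
    (hε : 0 < W.Δ → Nat.card (W.selmerGroup 2) = 4 → ¬ DescentSignNeg W) (b : ℕ) :
    ∃ ℓ : ℕ, b < ℓ ∧ ℓ.Prime ∧ ℓ % 8 = 7 ∧ ¬ ℓ ∣ W.conductorNorm ℤ ∧
      ((W.Δ < 0 ∧ ∃! x : ZMod ℓ, 4 * x ^ 3 + ((integralModelInt W).b₂ : ZMod ℓ) * x ^ 2 +
          2 * ((integralModelInt W).b₄ : ZMod ℓ) * x + ((integralModelInt W).b₆ : ZMod ℓ) = 0) ∨
        (0 < W.Δ ∧ ∀ x : ZMod ℓ, 4 * x ^ 3 + ((integralModelInt W).b₂ : ZMod ℓ) * x ^ 2 +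
          2 * ((integralModelInt W).b₄ : ZMod ℓ) * x + ((integralModelInt W).b₆ : ZMod ℓ) ≠ 0)) ∧
      ∃ (K : Type) (_ : Field K) (_ : NumberField K), IsImaginaryQuadratic K ∧ discr K = -(ℓ : ℤ) ∧ Odd (discr K) ∧
        discr K ≠ -3 ∧ SatisfiesHeegnerHypothesis (W.conductorNorm ℤ) K ∧
        ¬ IsSquare ((discr K : ℚ) * -|W.Δ|) ∧ ¬ IsSquare ((discr K : ℚ) * (-(2 * |W.Δ|))) ∧
        ((Ideal.span {(2 : ℤ)}).primesOver (𝓞 K)).ncard = 2 ∧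
        ∃ (Wd : WeierstrassCurve ℚ) (_ : Wd.IsElliptic) (_ : Wd.IsGloballyMinimal),
          (∃ C : VariableChange ℚ, C • W.quadraticTwist (discr K : ℚ) = Wd) ∧ Nat.card (Wd.selmerGroup 2) = 2 := by
  rcases lt_or_gt_of_ne W.isUnit_Δ.ne_zero with hΔ | hΔ
  · -- `Δ < 0`: prime Heegner fields are transposition fields (DEF = 1 for free)
    rcases h14 with h1 | h4
    · obtain ⟨K, _, _, ℓ, hℓ, hb, hK, hd, hodd, hd3, hH, hsq1, hsq2, h2K, huniq, Wd, _, _, hWd, hSel⟩ :=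
        exists_prime_heegnerField_minimalTwin_of_parity W hPT hEP hKP hsurj hΔ h1 b
      obtain ⟨-, hℓN, -⟩ := prime_discr_facts W hK hodd hH hℓ hd
      have hℓ8 : ℓ % 8 = 7 := by
        have h8 := (Quadratic.ncard_primesOver_two_eq_two_iff hK.1).mp h2K
        rw [hd] at h8
        omega
      exact ⟨ℓ, hb, hℓ, hℓ8, hℓN, Or.inl ⟨hΔ, huniq⟩, K, inferInstance, inferInstance, hK, hd, hodd, hd3, hH, hsq1, hsq2,
        h2K, Wd, inferInstance, inferInstance, hWd, hSel⟩
    · obtain ⟨ℓ, hℓ, hb, hℓ8, hℓ2N, K, _, _, hK, hd, hodd, hd3, hH, hsq1, hsq2, h2K, huniq, Wd, _, _, hWd, hSel⟩ :=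
        supply_DEF1_minimalTwin_rowOne_of_duality W hPT hEP hΔ hsurj h4 b
      have hℓN : ¬ ℓ ∣ W.conductorNorm ℤ := fun h => hℓ2N (Dvd.dvd.mul_left h 2)
      exact ⟨ℓ, hb, hℓ, hℓ8, hℓN, Or.inl ⟨hΔ, huniq⟩, K, inferInstance, inferInstance, hK, hd, hodd, hd3, hH, hsq1, hsq2,
        h2K, Wd, inferInstance, inferInstance, hWd, hSel⟩
  · -- `Δ > 0`: silent prime Heegner fields; `#Sel₂ = 1` by file 26, `#Sel₂ = 4` by the sign `ε(W)` through file 27's T-V on the habitat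
    rcases h14 with h1 | h4
    · obtain ⟨ℓ, hb, hℓ, hsil, K, _, _, hK, hd, hodd, hd3, hH, hsq1, hsq2, h2K, -, Wd, _, _, hWd, hSel⟩ :=
        supply_DEF1_posDisc_of_parity W hPT hEP hKP hΔ hsurj h1 b
      obtain ⟨-, hℓN, -⟩ := prime_discr_facts W hK hodd hH hℓ hd
      have hℓ8 : ℓ % 8 = 7 := by
        have h8 := (Quadratic.ncard_primesOver_two_eq_two_iff hK.1).mp h2K
        rw [hd] at h8
        omega
      exact ⟨ℓ, hb, hℓ, hℓ8, hℓN, Or.inr ⟨hΔ, hsil⟩, K, inferInstance, inferInstance, hK, hd, hodd, hd3, hH, hsq1, hsq2,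
        h2K, Wd, inferInstance, inferInstance, hWd, hSel⟩
    · obtain ⟨ℓ, hb, hℓ, hsil, K, _, _, hK, hd, hodd, hd3, hH, hsq1, hsq2, h2K, -, Wd, _, _, hWd, hSel⟩ :=
        supply_DEF1_posDisc_rowOne_of_not_descentSignNegAt W
          (strictShaPropagation_habitat_of_parity W hPT hEP hKP hsurj hΔ (by rw [selmerTwoCard, h4])) hΔ hsurj h4 (hε hΔ h4) b
      obtain ⟨-, hℓN, -⟩ := prime_discr_facts W hK hodd hH hℓ hd
      have hℓ8 : ℓ % 8 = 7 := by
        have h8 := (Quadratic.ncard_primesOver_two_eq_two_iff hK.1).mp h2K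
        rw [hd] at h8
        omega
      exact ⟨ℓ, hb, hℓ, hℓ8, hℓN, Or.inr ⟨hΔ, hsil⟩, K, inferInstance, inferInstance, hK, hd, hodd, hd3, hH, hsq1, hsq2,
        h2K, Wd, inferInstance, inferInstance, hWd, hSel⟩

/-- **The same under the habitat binder of crux 22136** (`ρ_{W,2^n}` onto for every `n ≥ 1`; the crux's `r_an(W) = 0` and the
Gross–Zagier–Kolyvagin fact are NOT needed for the supply any more) — SUPPLY″ on the habitat modulo {PT, Tate χ, Kramer parity} and
nothing from the cell. [cite: MazurRubin2010, Thm. 2.7, Prop. 3.3, Cor. 3.4 (i)] [cite: GrossLMS1991, §1 (p. 235)] -/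
theorem supply_DEF1_minimalTwin_habitat_of_parity'' (hKP : MazurRubin2010.kramerParity ℚ)
    (hPT : poitouTate_selmerStructure_duality_real ℚ)
    (hEP : ∀ v : IsDedekindDomain.HeightOneSpectrum (𝓞 ℚ), localEulerPoincareCharacteristic (v.adicCompletion ℚ))
    (hρ : ∀ n : ℕ, 0 < n → W.HasSurjectiveModNGaloisRep ((2 : ℤ) ^ n))
    (h14 : Nat.card (W.selmerGroup 2) = 1 ∨ Nat.card (W.selmerGroup 2) = 4)
    (hε : 0 < W.Δ → Nat.card (W.selmerGroup 2) = 4 → ¬ DescentSignNeg W) (b : ℕ) :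
    ∃ ℓ : ℕ, b < ℓ ∧ ℓ.Prime ∧ ℓ % 8 = 7 ∧ ¬ ℓ ∣ W.conductorNorm ℤ ∧
      ((W.Δ < 0 ∧ ∃! x : ZMod ℓ, 4 * x ^ 3 + ((integralModelInt W).b₂ : ZMod ℓ) * x ^ 2 +
          2 * ((integralModelInt W).b₄ : ZMod ℓ) * x + ((integralModelInt W).b₆ : ZMod ℓ) = 0) ∨
        (0 < W.Δ ∧ ∀ x : ZMod ℓ, 4 * x ^ 3 + ((integralModelInt W).b₂ : ZMod ℓ) * x ^ 2 +
          2 * ((integralModelInt W).b₄ : ZMod ℓ) * x + ((integralModelInt W).b₆ : ZMod ℓ) ≠ 0)) ∧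
      ∃ (K : Type) (_ : Field K) (_ : NumberField K), IsImaginaryQuadratic K ∧ discr K = -(ℓ : ℤ) ∧ Odd (discr K) ∧
        discr K ≠ -3 ∧ SatisfiesHeegnerHypothesis (W.conductorNorm ℤ) K ∧
        ¬ IsSquare ((discr K : ℚ) * -|W.Δ|) ∧ ¬ IsSquare ((discr K : ℚ) * (-(2 * |W.Δ|))) ∧
        ((Ideal.span {(2 : ℤ)}).primesOver (𝓞 K)).ncard = 2 ∧
        ∃ (Wd : WeierstrassCurve ℚ) (_ : Wd.IsElliptic) (_ : Wd.IsGloballyMinimal),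
          (∃ C : VariableChange ℚ, C • W.quadraticTwist (discr K : ℚ) = Wd) ∧ Nat.card (Wd.selmerGroup 2) = 2 := by
  exact supply_DEF1_minimalTwin_of_parity'' W hKP hPT hEP (by simpa using hρ 1 one_pos) h14 hε b

end Summit.BirchSwinnertonDyer.BirchSwinnertonDyer.Theorems.GenusKolyTwin

end
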